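import Summits.QuantumFields.BalabanUV.Beta.GAN24.CombCarrierKernelLegBlockL1
import Summits.QuantumFields.BalabanUV.Beta.GAN24.DressedSlotLegSplit

/-!
# `BalabanUV.Beta.GAN24.CombSlotLegSplit` — binder row G-an2-4 ∕ (CONV-C), TRANSFER-III (the (III′) column of RULING R-gan24p1-g46-2), THE COMB LEG DICTIONARY, SEVENTH WORD:
# **THE COMB-CHART CARRIER's COMPOSITE SLOT LEGS ARE DRESSED LEGS `r + d_zφ′` WITH leaf-12's ENVELOPES** — the (III′) twin of the OWNER's part 5 `GAN24/DressedSlotLegSplit`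
# (the `hE`, `hr`, `hr′`, `hφ` binders of leaf-01 g74's k₀-fold window for the comb-chart unit kernels `G′♮_j := unitK (sfStep Lc j) (smStep d Lc j) (GcombSh Lc j)`)
# (OWNER `b2b-balaban-gan24-p1`, gen 47; no existing file touched)

NOT IN PRINT; OUR BOOKKEEPING ([folklore] re-indexing BY NAME over the sixth word's `legChain_colH_comb` (the (III′) slot legs ARE the conjugated chains), the first word's
decomposition `legAct_legChain_psiLeg_eq`, leaf-03's `legAct_legChain_respStepBm`, leaf-01 g57's `DressedLegEnvelope` (`Psi_single_envelope`, `bmGaugeAt_respStep_envelope`), the second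
word's `PsiFace_apply_eq_sum ∕ abs_facePotential_legChain_single_le`, leaf-12's `exists_respStep_decay_and_grad`; 0 `def`, 0 cited facts, 0 `def … : Prop`, 0 sorry).  HONEST FRAMING
(cell contract, verbatim): «discharging `BetaPertH` makes Bałaban's UV stability UNCONDITIONAL — a real constructive-QFT result; it is NOT the continuum limit and NOT the Clay problem.»
HONEST DEPENDENCY (verbatim): «continuum YM on T⁴ ⇐ BetaPertH ∧ nine spine estimates (0/9 proved); BetaPertH ⇐ (D1) ∧ (D4) ∧ CAP+tail; G-an2-4 gates asym, D1 and NE2/3/4.»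

WHAT (roots FIXED at the centre by `GcombSh`: `r_c = ctrOff (d+1) Lc`, `ρ_c = toSite r_c = ctr (d+1) Lc`; point datum `1_{(μ,y)}`):
* §1 (generic `d`) **`legChain_comb_colH_eq`** — THE IDENTIFICATION `hE` AT (III′): `Push4Iter.legChain (j ↦ colH G′♮_j Lc) m k = fun μ y κ v ↦ respStep (Lc^m) (Lc^{m+k+1}) μ y κ v
  + (φ′ μ y (v + e_κ) − φ′ μ y v)` with the GAUGE POTENTIAL `φ′ μ y := Psi ρ_c Lc m k 1_{(μ,y)} + PsiFace r_c ρ_c Lc m k 1_{(μ,y)} − bmGaugeAt ρ_c (legAct (respStep (Lc^m) (Lc^{m+k+1})) 1_{(μ,y)}) Lc`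
  (a lambda, no `def`): part 5's `φ` PLUS the first word's face term — the sixth word's `legChain_colH_comb` ⨾ `legAct_single` ⨾ the first word ⨾ leaf-03's decomposition ⨾
  `axProjBmAt = · − grad (bmGaugeAt ·)`.  (road-P2 g56's M.59 `combLegChain_apply_eq_add_dz` is the same identity at `delta1`; here in part 5's `single` spelling, for the window.)
* §2 (`d = 3`, `2 ≤ Lc`) `abs_PsiFace_single_le` (PARAMETRIC in (N1): `|PsiFace r ρ Lc m k 1_{(μ,y)} v| ≤ faceWtSum r Lc·(1 + 8·Lc·(e^{κ₀}+1))·C·(Lc^{4(k+1)})⁻¹·E_y(v)` — the GEOMETRIC count over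
  the levels, FLAT in `k` (leaf-05 g87 X-CLE INFO I-1): `Σ_{i ≤ k} (Lc^{5(k−i+1)+4i})⁻¹ = (Lc^{5k+5})⁻¹·Σ_{i ≤ k} Lc^i ≤ 2·(Lc^{4k+5})⁻¹ ≤ (Lc^{4(k+1)})⁻¹`), and
  **`exists_comb_slotLeg_envelopes`** — ONE rate `κ₀ > 0` (leaf-12's) and constants `C, C′, Cφ′ ≥ 0` with, for ALL `m k`, at the SOURCE blocking `L = Lc^{k+1}`: sup
  `|respStep … μ y κ v| ≤ C·(Lc^{5(k+1)})⁻¹·E_y(v)`, unit gradient `≤ C′·(Lc^{6(k+1)})⁻¹·E_y(v)`, potential `|φ′ μ y v| ≤ Cφ′·(Lc^{4(k+1)})⁻¹·E_y(v)` with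
  `Cφ′ = 16C + 8·Lc·C + faceWtSum r_c Lc·(1 + 8·Lc·(e^{κ₀}+1))·C` — part 5's `exists_dressed_slotLeg_envelopes` VERBATIM for the comb-chart slot legs (no root quantifier).
So, BY NAME, with the sixth word (`exists_kChain_comb_blockMass`) EVERY input of leaf-01's window is typed for the (III′) carrier's objects with the (E) power ledger; what remains of
L11 at (III′) is MY parts 6a ∕ 6b re-run (`NaturalWindowH1 ∕ NaturalWindowShort` on these inputs) and leaf-03 g81's junction (W3).  Asserts NOTHING about Bałaban's tables beyond
leaf-12's (N1)∕(N1′) letters; NOT (H1♮); NOTHING of (Q-L) discharged; the (III′) campaign is NOT asked (an2 W-4) — typed while idle under R-2; NEVER «G-an2-4 closed» as (CONV-C);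
NOT D1, NOT `BetaPertH`, NOT continuum, NOT Clay.  2026-08-25.
-/

noncomputable section

open Finset
open scoped BigOperators
open Literature.MathematicalPhysics.QuantumFieldTheory
open Literature.MathematicalPhysics.QuantumFieldTheory.LatticeForm (quo)
open Literature.MathematicalPhysics.QuantumFieldTheory.Balaban1983to89
open Literature.MathematicalPhysics.QuantumFieldTheory.Balaban1983to89.Beta
open B4ContourShift (supNorm)
open OneStepKernelFamily (KInvStep colH)
open AffineAveraging (Form0 Form1 Site box toSite dz)
open B6BondElimination (unitVec)
open AveragingContours (blk grad grad_eq_dz)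
open AveragingContoursRooted (ctr ctrOff ctrOff_mem_box)
open BalabanCompositeJets (respStep)
open Summit.QuantumFields.BalabanUV.Beta.HessKerDressedUnits (unitK)
open Summit.QuantumFields.BalabanUV.Beta.AxialProjectorBlockMean (bmGaugeAt axProjBmAt)
open Summit.QuantumFields.BalabanUV.Beta.SymCorrectorKernel (psiKS)
open Summit.QuantumFields.BalabanUV.Beta.SymCorrectorFace (faceWtSum faceWtSum_nonneg)
open Summit.QuantumFields.BalabanUV.Beta.CombChartStepJets (GcombSh)
open Summit.QuantumFields.BalabanUV.Beta.GAN24.CombesThomas (sfStep smStep)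
open Summit.QuantumFields.BalabanUV.Beta.GAN24.Push4 (legComp)
open Summit.QuantumFields.BalabanUV.Beta.GAN24.Push4Iter (LegFam legChain)
open Summit.QuantumFields.BalabanUV.Beta.GAN24.RespStepBmDecompLegs (legAct)
open Summit.QuantumFields.BalabanUV.Beta.GAN24.RespStepBmDecompExact (respStepBmSeq)
open Summit.QuantumFields.BalabanUV.Beta.GAN24.RespStepBmDecompPsi (Psi legAct_legChain_respStepBm)
open Summit.QuantumFields.BalabanUV.Beta.GAN24.RespStepDecay (exists_respStep_decay_and_grad)
open Summit.QuantumFields.BalabanUV.Beta.GAN24.UndressedResponseUnits (inv_cast_pow_pow)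
open Summit.QuantumFields.BalabanUV.Beta.GAN24.DressedLegEnvelope (bmGaugeAt_respStep_envelope Psi_single_envelope blk_pow_blk_pow legAct_single summable_single_and_le)
open Summit.QuantumFields.BalabanUV.Beta.GAN24.DressedLegUnits (geom_sum_le_of_two_le)
open Summit.QuantumFields.BalabanUV.Beta.GAN24.ContactOneGaugeCellAlgebra (affine_unitVec_eq)
open Summit.QuantumFields.BalabanUV.Beta.GAN24.CombLegChainGauge (facePotential PsiFace legAct_legChain_psiLeg_eq)
open Summit.QuantumFields.BalabanUV.Beta.GAN24.CombLegFaceSawtoothBlockL1 (PsiFace_apply_eq_sum abs_facePotential_legChain_single_le)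
open Summit.QuantumFields.BalabanUV.Beta.GAN24.CombCarrierKernelLegBlockL1 (legChain_colH_comb)

namespace Summit.QuantumFields.BalabanUV.Beta.GAN24.CombSlotLegSplit

variable {d : ℕ}

/-! ## §1 The identification `hE` at (III′) -/

section Identity

variable {Lc : ℕ} [NeZero Lc]

/-- NOT IN PRINT; OUR BOOKKEEPING.  **THE IDENTIFICATION `hE` AT (III′): THE COMB-CHART CARRIER's COMPOSITE SLOT LEGS ARE THE UNDRESSED COMPOSITE RESPONSE PLUS A UNIT GRADIENT**
(as displayed in the module docstring; centred roots; every `m k`; `e_κ = B6BondElimination.unitVec κ`, the window's spelling) — the sixth word's `legChain_colH_comb` (slot legs =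
conjugated chains) ⨾ the first word's decomposition ⨾ leaf-03's; the potential is part 5's `Ψ − bmGaugeAt` PLUS the face term `PsiFace`. -/
theorem legChain_comb_colH_eq (m k : ℕ) :
    legChain (fun j => colH (unitK (sfStep Lc j) (smStep d Lc j) (GcombSh (d := d) Lc j)) Lc) m k
      = fun μ y κ v =>
          respStep (d := d) (Lc ^ m) (Lc ^ (m + k + 1)) μ y κ v
            + ((fun (μ : Fin (d + 1)) (y v : Site (d + 1)) =>
                  Psi (toSite (ctrOff (d + 1) Lc)) Lc m k (fun μ' y' => if μ' = μ then (if y' = y then (1 : ℝ) else 0) else 0) v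
                    + PsiFace (ctrOff (d + 1) Lc) (toSite (ctrOff (d + 1) Lc)) Lc m k (fun μ' y' => if μ' = μ then (if y' = y then (1 : ℝ) else 0) else 0) v
                    - bmGaugeAt (toSite (ctrOff (d + 1) Lc)) (legAct (respStep (d := d) (Lc ^ m) (Lc ^ (m + k + 1)))
                        (fun μ' y' => if μ' = μ then (if y' = y then (1 : ℝ) else 0) else 0)) Lc v) μ y (v + unitVec κ)
              - (fun (μ : Fin (d + 1)) (y v : Site (d + 1)) =>
                  Psi (toSite (ctrOff (d + 1) Lc)) Lc m k (fun μ' y' => if μ' = μ then (if y' = y then (1 : ℝ) else 0) else 0) v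
                    + PsiFace (ctrOff (d + 1) Lc) (toSite (ctrOff (d + 1) Lc)) Lc m k (fun μ' y' => if μ' = μ then (if y' = y then (1 : ℝ) else 0) else 0) v
                    - bmGaugeAt (toSite (ctrOff (d + 1) Lc)) (legAct (respStep (d := d) (Lc ^ m) (Lc ^ (m + k + 1)))
                        (fun μ' y' => if μ' = μ then (if y' = y then (1 : ℝ) else 0) else 0)) Lc v) μ y v) := by
  have hLc : 0 < Lc := Nat.pos_of_ne_zero (NeZero.ne Lc)
  have hr : ctrOff (d + 1) Lc ∈ box (d + 1) Lc := ctrOff_mem_box hLc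
  funext μ y κ v
  rw [legChain_colH_comb,
    ← legAct_single (legChain (fun j => legComp (fun α x κ u => psiKS (ctrOff (d + 1) Lc) Lc u x (Sum.inl κ) (Sum.inl α))
        (respStepBmSeq (d := d) (toSite (ctrOff (d + 1) Lc)) Lc j)) m k) μ y κ v,
    legAct_legChain_psiLeg_eq hr hr k m (summable_single_and_le (d := d) μ y).1,
    legAct_legChain_respStepBm hr m k (summable_single_and_le (d := d) μ y).1]
  simp only [Pi.add_apply, Pi.sub_apply, axProjBmAt, grad, dz, legAct_single, affine_unitVec_eq]
  ring

end Identity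

/-! ## §2 The envelopes (`d = 3`) -/

section Three

variable {Lc : ℕ} [NeZero Lc]

/-- NOT IN PRINT; OUR BOOKKEEPING.  **THE FACE TERM IN SUP, FLAT IN THE LENGTH** (`d = 3`, `2 ≤ Lc`, in-block roots; PARAMETRIC in (N1) `κ₀ ≥ 0`, `C ≥ 0`): for ALL `m k μ y v`,
`|PsiFace r ρ Lc m k 1_{(μ,y)} v| ≤ faceWtSum r Lc·(1 + 8·Lc·(e^{κ₀}+1))·C·(Lc^{4(k+1)})⁻¹·e^{−κ₀‖quo (Lc^{k+1}) v − y‖∞}` — the second word's per-level sup `(Lc^{5(k−i+1)})⁻¹·(Lc^{4i})⁻¹·E`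
(`PsiFace_apply_eq_sum`, `abs_facePotential_legChain_single_le`) summed by the GEOMETRIC count `(Lc^{5k+5})⁻¹·Σ_{i ≤ k} Lc^i ≤ 2·(Lc^{4k+5})⁻¹ ≤ (Lc^{4(k+1)})⁻¹` (leaf-01's
`geom_sum_le_of_two_le`): NO `(k+1)` — the finest level dominates in sup (leaf-05 g87 X-CLE INFO I-1 answered). -/
theorem abs_PsiFace_single_le (hLc : 2 ≤ Lc) {κ₀ C : ℝ} (hκ : 0 ≤ κ₀) (hC : 0 ≤ C)
    (hN1 : ∀ (m k : ℕ) (μ : Fin (3 + 1)) (z : Site (3 + 1)) (l'' : Fin (3 + 1)) (w' : Site (3 + 1)),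
      |respStep (d := 3) (Lc ^ m) (Lc ^ (m + k + 1)) μ z l'' w'| ≤
        C * ((Lc : ℝ) ^ (5 * (k + 1)))⁻¹ * Real.exp (-(κ₀ * supNorm (quo (Lc ^ (k + 1)) w' - z))))
    {r : Fin (3 + 1) → ℕ} (hr : r ∈ box (3 + 1) Lc) {rr : Fin (3 + 1) → ℕ} (hrr : rr ∈ box (3 + 1) Lc)
    (m k : ℕ) (μ : Fin (3 + 1)) (y v : Site (3 + 1)) :
    |PsiFace r (toSite rr) Lc m k (fun μ' y' => if μ' = μ then (if y' = y then (1 : ℝ) else 0) else 0) v|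
      ≤ faceWtSum r Lc * (1 + 8 * (Lc : ℝ) * (Real.exp κ₀ + 1)) * C * ((Lc : ℝ) ^ (4 * (k + 1)))⁻¹ *
          Real.exp (-(κ₀ * supNorm (quo (Lc ^ (k + 1)) v - y))) := by
  have hL : (2 : ℝ) ≤ Lc := by exact_mod_cast hLc
  have hL0 : (0 : ℝ) < Lc := by linarith
  have hF0 := faceWtSum_nonneg r Lc
  set Φ : ℝ := Real.exp (-(κ₀ * supNorm (quo (Lc ^ (k + 1)) v - y))) with hΦ
  have hΦ0 : 0 ≤ Φ := (Real.exp_pos _).le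
  set A : ℝ := faceWtSum r Lc * (1 + 8 * (Lc : ℝ) * (Real.exp κ₀ + 1)) * C with hA
  have hA0 : 0 ≤ A := by positivity
  rw [PsiFace_apply_eq_sum (toSite rr) k m]
  -- the level-`i` term: amplitude `A · (Lc^{5(k−i+1)})⁻¹ · (Lc^{4i})⁻¹ = A · (Lc^{5k+5})⁻¹ · Lc^i`, the SAME envelope `Φ`
  have hterm : ∀ i ∈ Finset.range (k + 1),
      |((Lc : ℝ) ^ ((3 + 1) * i))⁻¹ *
          facePotential r Lc (legAct (legChain (respStepBmSeq (d := 3) (toSite rr) Lc) (m + i) (k - i))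
            (fun μ' y' => if μ' = μ then (if y' = y then (1 : ℝ) else 0) else 0)) (blk (Lc ^ i) v)|
        ≤ A * Φ * ((Lc : ℝ) ^ (5 * k + 5))⁻¹ * (Lc : ℝ) ^ i := by
    intro i hi
    have hik : i ≤ k := Nat.lt_succ_iff.1 (Finset.mem_range.1 hi)
    have h := abs_facePotential_legChain_single_le hκ hC hN1 hr hrr (m + i) (k - i) μ y (blk (Lc ^ i) v)
    have hlab : quo (Lc ^ (k - i + 1)) (blk (Lc ^ i) v) = quo (Lc ^ (k + 1)) v := by
      show blk (Lc ^ (k - i + 1)) (blk (Lc ^ i) v) = blk (Lc ^ (k + 1)) v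
      rw [blk_pow_blk_pow, show i + (k - i + 1) = k + 1 by omega]
    rw [hlab, ← hΦ] at h
    rw [abs_mul, abs_inv, abs_pow, abs_of_pos hL0]
    calc ((Lc : ℝ) ^ ((3 + 1) * i))⁻¹ * |facePotential r Lc (legAct (legChain (respStepBmSeq (d := 3) (toSite rr) Lc) (m + i) (k - i))
            (fun μ' y' => if μ' = μ then (if y' = y then (1 : ℝ) else 0) else 0)) (blk (Lc ^ i) v)|
        ≤ ((Lc : ℝ) ^ ((3 + 1) * i))⁻¹ * (faceWtSum r Lc * ((1 + 8 * (Lc : ℝ) * (Real.exp κ₀ + 1)) * C * ((Lc : ℝ) ^ (5 * (k - i + 1)))⁻¹ * Φ)) :=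
          mul_le_mul_of_nonneg_left h (by positivity)
      _ = A * Φ * ((Lc : ℝ) ^ (5 * k + 5))⁻¹ * (Lc : ℝ) ^ i := by
          have e : (Lc : ℝ) ^ (5 * k + 5) = (Lc : ℝ) ^ ((3 + 1) * i) * (Lc : ℝ) ^ (5 * (k - i + 1)) * (Lc : ℝ) ^ i := by
            rw [← pow_add, ← pow_add]; congr 1; omega
          rw [e, hA]
          field_simp
  refine (Finset.abs_sum_le_sum_abs _ _).trans ((Finset.sum_le_sum hterm).trans ?_)
  rw [← Finset.mul_sum]
  -- the geometric count: `Σ_{i ≤ k} Lc^i ≤ 2·Lc^{k+1}/Lc`, and `2·Lc^k·(Lc^{5k+5})⁻¹ ≤ (Lc^{4(k+1)})⁻¹` at `2 ≤ Lc`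
  have hgeo := geom_sum_le_of_two_le hL (k + 1)
  have hB0 : 0 ≤ A * Φ * ((Lc : ℝ) ^ (5 * k + 5))⁻¹ := by positivity
  refine (mul_le_mul_of_nonneg_left hgeo hB0).trans ?_
  have e1 : (Lc : ℝ) ^ (5 * k + 5) = (Lc : ℝ) ^ (4 * (k + 1)) * (Lc : ℝ) ^ (k + 1) := by rw [← pow_add]; congr 1; ring
  rw [e1, hA]
  rw [show faceWtSum r Lc * (1 + 8 * (Lc : ℝ) * (Real.exp κ₀ + 1)) * C * Φ * ((Lc : ℝ) ^ (4 * (k + 1)) * (Lc : ℝ) ^ (k + 1))⁻¹ * (2 * (Lc : ℝ) ^ (k + 1) / Lc)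
      = faceWtSum r Lc * (1 + 8 * (Lc : ℝ) * (Real.exp κ₀ + 1)) * C * ((Lc : ℝ) ^ (4 * (k + 1)))⁻¹ * Φ * (2 / Lc) by
        field_simp]
  have h2 : 2 / (Lc : ℝ) ≤ 1 := by rw [div_le_one hL0]; exact hL
  have hK0 : 0 ≤ faceWtSum r Lc * (1 + 8 * (Lc : ℝ) * (Real.exp κ₀ + 1)) * C * ((Lc : ℝ) ^ (4 * (k + 1)))⁻¹ * Φ := by positivity
  calc _ ≤ faceWtSum r Lc * (1 + 8 * (Lc : ℝ) * (Real.exp κ₀ + 1)) * C * ((Lc : ℝ) ^ (4 * (k + 1)))⁻¹ * Φ * 1 := mul_le_mul_of_nonneg_left h2 hK0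
    _ = _ := by ring

/-- NOT IN PRINT; OUR BOOKKEEPING.  **THE ENVELOPES OF THE THREE PIECES AT THE SOURCE BLOCKING `L = Lc^{k+1}` FOR THE COMB-CHART SLOT LEGS** (as displayed in the module
docstring; centred roots, no root quantifier): leaf-12's (N1)∕(N1′) for the undressed composite response (`exists_respStep_decay_and_grad`), leaf-01 g57's `Psi_single_envelope` +
`bmGaugeAt_respStep_envelope` + §2's `abs_PsiFace_single_le` for the potential `φ′` (`Cφ′ = 16C + 8·Lc·C + faceWtSum r_c Lc·(1 + 8·Lc·(e^{κ₀}+1))·C`) — part 5's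
`exists_dressed_slotLeg_envelopes` for the (III′) legs. -/
theorem exists_comb_slotLeg_envelopes (hLc : 2 ≤ Lc) :
    ∃ κ₀ C C' Cφ : ℝ, 0 < κ₀ ∧ 0 ≤ C ∧ 0 ≤ C' ∧ 0 ≤ Cφ ∧ ∀ (m k : ℕ),
      (∀ (μ : Fin (3 + 1)) (y : Site (3 + 1)) (κ : Fin (3 + 1)) (v : Site (3 + 1)),
          |respStep (d := 3) (Lc ^ m) (Lc ^ (m + k + 1)) μ y κ v|
            ≤ C * ((Lc : ℝ) ^ (5 * (k + 1)))⁻¹ * Real.exp (-(κ₀ * supNorm (quo (Lc ^ (k + 1)) v - y)))) ∧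
      (∀ (μ : Fin (3 + 1)) (y : Site (3 + 1)) (κ : Fin (3 + 1)) (v : Site (3 + 1)) (i : Fin (3 + 1)),
          |respStep (d := 3) (Lc ^ m) (Lc ^ (m + k + 1)) μ y κ (v + Pi.single i 1) - respStep (d := 3) (Lc ^ m) (Lc ^ (m + k + 1)) μ y κ v|
            ≤ C' * ((Lc : ℝ) ^ (6 * (k + 1)))⁻¹ * Real.exp (-(κ₀ * supNorm (quo (Lc ^ (k + 1)) v - y)))) ∧
      (∀ (μ : Fin (3 + 1)) (y v : Site (3 + 1)),
          |Psi (toSite (ctrOff (3 + 1) Lc)) Lc m k (fun μ' y' => if μ' = μ then (if y' = y then (1 : ℝ) else 0) else 0) v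
              + PsiFace (ctrOff (3 + 1) Lc) (toSite (ctrOff (3 + 1) Lc)) Lc m k (fun μ' y' => if μ' = μ then (if y' = y then (1 : ℝ) else 0) else 0) v
              - bmGaugeAt (toSite (ctrOff (3 + 1) Lc)) (legAct (respStep (d := 3) (Lc ^ m) (Lc ^ (m + k + 1)))
                  (fun μ' y' => if μ' = μ then (if y' = y then (1 : ℝ) else 0) else 0)) Lc v|
            ≤ Cφ * ((Lc : ℝ) ^ (4 * (k + 1)))⁻¹ * Real.exp (-(κ₀ * supNorm (quo (Lc ^ (k + 1)) v - y)))) := by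
  obtain ⟨κ₀, C, C', hκ₀, hC, hC', hN1', hN1g'⟩ := exists_respStep_decay_and_grad (Lc := Lc)
  have hN1 : ∀ (m k : ℕ) (μ : Fin (3 + 1)) (z : Site (3 + 1)) (l'' : Fin (3 + 1)) (w' : Site (3 + 1)),
      |respStep (d := 3) (Lc ^ m) (Lc ^ (m + k + 1)) μ z l'' w'| ≤
        C * ((Lc : ℝ) ^ (5 * (k + 1)))⁻¹ * Real.exp (-(κ₀ * supNorm (quo (Lc ^ (k + 1)) w' - z))) := by
    intro m k μ z l'' w'
    have h := hN1' m k μ z l'' w'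
    rwa [inv_cast_pow_pow] at h
  have hN1g : ∀ (m k : ℕ) (μ : Fin (3 + 1)) (z : Site (3 + 1)) (l'' : Fin (3 + 1)) (w' : Site (3 + 1)) (ν : Fin (3 + 1)),
      |respStep (d := 3) (Lc ^ m) (Lc ^ (m + k + 1)) μ z l'' (w' + Pi.single ν 1) - respStep (d := 3) (Lc ^ m) (Lc ^ (m + k + 1)) μ z l'' w'| ≤
        C' * ((Lc : ℝ) ^ (6 * (k + 1)))⁻¹ * Real.exp (-(κ₀ * supNorm (quo (Lc ^ (k + 1)) w' - z))) := by
    intro m k μ z l'' w' ν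
    have h := hN1g' m k μ z l'' w' ν
    rwa [inv_cast_pow_pow] at h
  have hLc1 : 1 ≤ Lc := le_trans (by norm_num) hLc
  have hL1 : (1 : ℝ) ≤ Lc := by exact_mod_cast hLc1
  have hr : ctrOff (3 + 1) Lc ∈ box (3 + 1) Lc := ctrOff_mem_box hLc1
  have hF0 := faceWtSum_nonneg (ctrOff (3 + 1) Lc) Lc
  refine ⟨κ₀, C, C', 16 * C + 8 * (Lc : ℝ) * C + faceWtSum (ctrOff (3 + 1) Lc) Lc * (1 + 8 * (Lc : ℝ) * (Real.exp κ₀ + 1)) * C,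
    hκ₀, hC, hC', by positivity, ?_⟩
  intro m k
  refine ⟨fun μ y κ v => hN1 m k μ y κ v, fun μ y κ v i => hN1g m k μ y κ v i, fun μ y v => ?_⟩
  -- the potential: `|Ψ| + |PsiFace| + |bm gauge|`
  have hPsi := Psi_single_envelope (Lc := Lc) hLc hC hN1 hr m k μ y v
  have hFace := abs_PsiFace_single_le (Lc := Lc) hLc hκ₀.le hC hN1 hr hr m k μ y v
  have hg := bmGaugeAt_respStep_envelope (Lc := Lc) hN1 hr m k (m + k + 1) rfl μ y v
  have hlab : blk (Lc ^ k) (blk Lc v) = quo (Lc ^ (k + 1)) v := by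
    have h1 := blk_pow_blk_pow Lc k 1 v
    rw [pow_one, show 1 + k = k + 1 by ring] at h1
    rw [h1]; rfl
  rw [hlab] at hg
  have hpow : ((Lc : ℝ) ^ (5 * (k + 1)))⁻¹ ≤ ((Lc : ℝ) ^ (4 * (k + 1)))⁻¹ :=
    inv_anti₀ (by positivity) (pow_le_pow_right₀ hL1 (by omega))
  have hE0 : 0 ≤ Real.exp (-(κ₀ * supNorm (quo (Lc ^ (k + 1)) v - y))) := (Real.exp_pos _).le
  have hg' : |bmGaugeAt (toSite (ctrOff (3 + 1) Lc)) (legAct (respStep (d := 3) (Lc ^ m) (Lc ^ (m + k + 1)))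
        (fun μ' y' => if μ' = μ then (if y' = y then (1 : ℝ) else 0) else 0)) Lc v|
      ≤ 8 * (Lc : ℝ) * C * ((Lc : ℝ) ^ (4 * (k + 1)))⁻¹ * Real.exp (-(κ₀ * supNorm (quo (Lc ^ (k + 1)) v - y))) := by
    refine hg.trans ?_
    have h8 : 0 ≤ 8 * (Lc : ℝ) * C := by positivity
    exact mul_le_mul_of_nonneg_right (mul_le_mul_of_nonneg_left hpow h8) hE0
  calc _ ≤ |Psi (toSite (ctrOff (3 + 1) Lc)) Lc m k (fun μ' y' => if μ' = μ then (if y' = y then (1 : ℝ) else 0) else 0) v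
          + PsiFace (ctrOff (3 + 1) Lc) (toSite (ctrOff (3 + 1) Lc)) Lc m k (fun μ' y' => if μ' = μ then (if y' = y then (1 : ℝ) else 0) else 0) v|
        + |bmGaugeAt (toSite (ctrOff (3 + 1) Lc)) (legAct (respStep (d := 3) (Lc ^ m) (Lc ^ (m + k + 1)))
            (fun μ' y' => if μ' = μ then (if y' = y then (1 : ℝ) else 0) else 0)) Lc v| := abs_sub _ _
    _ ≤ (16 * C * ((Lc : ℝ) ^ (4 * (k + 1)))⁻¹ * Real.exp (-(κ₀ * supNorm (quo (Lc ^ (k + 1)) v - y)))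
          + faceWtSum (ctrOff (3 + 1) Lc) Lc * (1 + 8 * (Lc : ℝ) * (Real.exp κ₀ + 1)) * C * ((Lc : ℝ) ^ (4 * (k + 1)))⁻¹ *
              Real.exp (-(κ₀ * supNorm (quo (Lc ^ (k + 1)) v - y))))
        + 8 * (Lc : ℝ) * C * ((Lc : ℝ) ^ (4 * (k + 1)))⁻¹ * Real.exp (-(κ₀ * supNorm (quo (Lc ^ (k + 1)) v - y))) :=
        add_le_add ((abs_add_le _ _).trans (add_le_add hPsi hFace)) hg'
    _ = _ := by ring

end Three

end Summit.QuantumFields.BalabanUV.Beta.GAN24.CombSlotLegSplit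

end
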